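import Literature.Probability.RandomPlanarGeometry.HexSAWPolygonCellsRoof
import HarnessLib

/-!
# Cell calculus for honeycomb polygon surgery, VI: PEELING the free up-right spikes — the base `B(S)` of the decomposition

Topic `Literature/Probability/RandomPlanarGeometry` (lane «pcv-sawmu», a-p4 g21; sequel of `HexSAWPolygonCells.lean`, `…CellsRoof.lean`).

LEMMA D of `HOME/pub-sawmu-a-p4/g21/omega/THEOREM-OMEGA-g21.md` §3 decomposes every cell set `S` as `B ⊔ (up-right sticks on hosts of B)` by
PEELING: while the top hexagon `m` is an up-right spike (its only contact is `LL m`) and removing it does not produce the «roof-end» situation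
(the rest is of type R and `m` sits at the far end of its roof) and `S` is not the 3-chain, remove `m`.  This file DEFINES the peeling
(`peel`, by well-founded recursion on `#S`), the predicates it consults (`IsSpikeTop`, `RoofEndSituation`, `IsChain3`), and proves the basic
facts: `peel S ⊆ S`, `#(peel S) ≤ #S`, the fixed-point characterisation `peel_eq_self_iff`, and the one-step unfolding `peel_eq_peel_erase`.
The identification of `S ∖ peel S` as a union of sticks on hosts of `peel S` (the second half of Lemma D) is the subject of the sequel.

Sources: N. Madras, G. Slade, *The Self-Avoiding Walk* (1993), §3.2, proof of Theorem 3.2.3 [MadrasSlade1993]; I. Jensen, J. Phys.: Conf.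
Ser. 42 (2006) 163 [Jensen2006HoneycombPolygons].  Label (lane): LANE INFRASTRUCTURE; nothing new in writing.
-/

open Finset

namespace Literature.Probability.RandomPlanarGeometry.SAW

namespace HexCell

/-- `m` is the top hexagon of `S` AND an up-right spike: its only contact is `LL m`.
[cite: MadrasSlade1993, §3.2 (proof of Theorem 3.2.3: the configuration at the largest point)] -/
def IsSpikeTop (S : Finset Cell) (m : Cell) : Prop := IsLexmax S m ∧ nbrs m ∩ S = {LL m}

/-- The «roof-end situation» for `(T, d)`: `T` is of type R at its top `t` (`L t ∉ T`, `LR t ∈ T`) with run `e_0..e_{k−1}`, `e_k ∉ T`, `k ≥ 2`,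
and `d = e_{k−1}` — then the spike `UR d` is the last roof cell and the polygon `T + UR d` is a base («RU»), not peeled further.
[cite: MadrasSlade1993, §3.2 (proof of Theorem 3.2.3)] -/
def RoofEndSituation (T : Finset Cell) (d : Cell) : Prop :=
  ∃ t : Cell, ∃ k : ℕ, IsLexmax T t ∧ L t ∉ T ∧ 2 ≤ k ∧ (∀ i < k, runCell t i ∈ T) ∧ runCell t k ∉ T ∧ d = runCell t (k - 1)

/-- The up-right 3-chain `{p, UR p, UR² p}` (the base `C₂` with its special image). [cite: MadrasSlade1993, §3.2 (proof of Theorem 3.2.3)] -/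
def IsChain3 (S : Finset Cell) : Prop := ∃ p : Cell, S = {p, UR p, UR (UR p)}

/-- `S` is PEELABLE at `m`: `m` is a spike top, removing it is not the roof-end situation, and `S` is not the 3-chain.
[cite: MadrasSlade1993, §3.2 (proof of Theorem 3.2.3)] -/
def Peelable (S : Finset Cell) (m : Cell) : Prop := IsSpikeTop S m ∧ ¬ RoofEndSituation (S.erase m) (LL m) ∧ ¬ IsChain3 S

/-- A peelable top is a member. [cite: MadrasSlade1993, §3.2 (proof of Theorem 3.2.3)] -/
theorem Peelable.mem {S : Finset Cell} {m : Cell} (h : Peelable S m) : m ∈ S := h.1.1.1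

/-- The peelable top is unique (it is the top hexagon). [cite: MadrasSlade1993, §3.2 (proof of Theorem 3.2.3)] -/
theorem Peelable.unique {S : Finset Cell} {m m' : Cell} (h : Peelable S m) (h' : Peelable S m') : m = m' :=
  h.1.1.unique h'.1.1

open Classical in
/-- **The peeling** `peel S`: remove peelable tops while possible (well-founded recursion on `#S`).
[cite: MadrasSlade1993, §3.2 (proof of Theorem 3.2.3: iterating the removal of the extremal unit)] -/
noncomputable def peel (S : Finset Cell) : Finset Cell :=
  if h : ∃ m, Peelable S m then
    have : #(S.erase (Classical.choose h)) < #S := card_erase_lt_of_mem (Classical.choose_spec h).mem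
    peel (S.erase (Classical.choose h))
  else S
termination_by #S

open Classical in
/-- One peeling step. [cite: MadrasSlade1993, §3.2 (proof of Theorem 3.2.3)] -/
theorem peel_eq_peel_erase {S : Finset Cell} {m : Cell} (h : Peelable S m) : peel S = peel (S.erase m) := by
  have hex : ∃ m, Peelable S m := ⟨m, h⟩
  have hm : Classical.choose hex = m := (Classical.choose_spec hex).unique h
  rw [peel, dif_pos hex]
  simp only [hm]

open Classical in
/-- No peelable top: `peel S = S`. [cite: MadrasSlade1993, §3.2 (proof of Theorem 3.2.3)] -/
theorem peel_eq_self {S : Finset Cell} (h : ¬ ∃ m, Peelable S m) : peel S = S := by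
  rw [peel, dif_neg h]

open Classical in
/-- `peel S ⊆ S`. [cite: MadrasSlade1993, §3.2 (proof of Theorem 3.2.3)] -/
theorem peel_subset (S : Finset Cell) : peel S ⊆ S := by
  induction S using Finset.strongInduction with
  | H S ih =>
    by_cases h : ∃ m, Peelable S m
    · obtain ⟨m, hm⟩ := h
      rw [peel_eq_peel_erase hm]
      exact (ih _ (erase_ssubset hm.mem)).trans (erase_subset _ _)
    · rw [peel_eq_self h]

/-- `#(peel S) ≤ #S`. [cite: MadrasSlade1993, §3.2 (proof of Theorem 3.2.3)] -/
theorem card_peel_le (S : Finset Cell) : #(peel S) ≤ #S := card_le_card (peel_subset S)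

open Classical in
/-- The base is a fixed point: `peel (peel S) = peel S`, i.e. `peel S` has no peelable top.
[cite: MadrasSlade1993, §3.2 (proof of Theorem 3.2.3)] -/
theorem not_exists_peelable_peel (S : Finset Cell) : ¬ ∃ m, Peelable (peel S) m := by
  induction S using Finset.strongInduction with
  | H S ih =>
    by_cases h : ∃ m, Peelable S m
    · obtain ⟨m, hm⟩ := h
      rw [peel_eq_peel_erase hm]
      exact ih _ (erase_ssubset hm.mem)
    · rw [peel_eq_self h]; exact h

/-- `peel S = S ↔ S` has no peelable top. [cite: MadrasSlade1993, §3.2 (proof of Theorem 3.2.3)] -/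
theorem peel_eq_self_iff {S : Finset Cell} : peel S = S ↔ ¬ ∃ m, Peelable S m := by
  constructor
  · intro h; rw [← h]; exact not_exists_peelable_peel S
  · exact peel_eq_self

/-- Peeling strictly shrinks a peelable set. [cite: MadrasSlade1993, §3.2 (proof of Theorem 3.2.3)] -/
theorem card_peel_lt {S : Finset Cell} {m : Cell} (h : Peelable S m) : #(peel S) < #S := by
  rw [peel_eq_peel_erase h]
  exact (card_peel_le _).trans_lt (card_erase_lt_of_mem h.mem)

/-- The removed part `S ∖ peel S` («the free sticks») has `#S − #(peel S)` hexagons. [cite: MadrasSlade1993, §3.2 (proof of Theorem 3.2.3)] -/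
theorem card_sdiff_peel (S : Finset Cell) : #(S \ peel S) = #S - #(peel S) :=
  card_sdiff_of_subset (peel_subset S)

/-- Peeling a spike top lowers the perimeter by `4` at each step: `perim S = perim (peel S) + 4 · #(S ∖ peel S)`.
[cite: MadrasSlade1993, §3.2 (proof of Theorem 3.2.3: length bookkeeping)] -/
theorem perim_eq_perim_peel_add (S : Finset Cell) : perim S = perim (peel S) + 4 * #(S \ peel S) := by
  classical
  induction S using Finset.strongInduction with
  | H S ih =>
    by_cases h : ∃ m, Peelable S m
    · obtain ⟨m, hm⟩ := h
      have hstep : perim (S.erase m) + 4 = perim S := by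
        apply perim_erase_of_contacts_eq_one hm.mem
        -- contacts of `m` in `S.erase m` = contacts in `S` (m is not its own neighbour) = {LL m}
        have : nbrs m ∩ S.erase m = nbrs m ∩ S := by
          ext c
          simp only [mem_inter, mem_erase]
          constructor
          · rintro ⟨h1, -, h2⟩; exact ⟨h1, h2⟩
          · rintro ⟨h1, h2⟩; exact ⟨h1, fun e => self_notMem_nbrs m (e ▸ h1), h2⟩
        rw [this, hm.1.2, card_singleton]
      have hsub : peel (S.erase m) ⊆ S.erase m := peel_subset _
      have hih := ih _ (erase_ssubset hm.mem)
      rw [peel_eq_peel_erase hm, ← hstep, hih]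
      -- #(S \ peel (S.erase m)) = #(S.erase m \ peel (S.erase m)) + 1
      have hm' : m ∉ peel (S.erase m) := fun hx => notMem_erase m S (hsub hx)
      have : S \ peel (S.erase m) = insert m (S.erase m \ peel (S.erase m)) := by
        ext c
        simp only [mem_sdiff, mem_insert, mem_erase]
        constructor
        · rintro ⟨hc, hnp⟩
          by_cases e : c = m
          · exact Or.inl e
          · exact Or.inr ⟨⟨e, hc⟩, hnp⟩
        · rintro (rfl | ⟨⟨-, hc⟩, hnp⟩)
          · exact ⟨hm.mem, hm'⟩
          · exact ⟨hc, hnp⟩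
      rw [this, card_insert_of_notMem (by simp)]
      ring
    · rw [peel_eq_self h]; simp

end HexCell

end Literature.Probability.RandomPlanarGeometry.SAW
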